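import Summits.ABC.ABC.Statement
import Literature.NumberTheory.DiophantineGeometry.GenEllThm21PrimesHolds
import Mathlib.Topology.Order.Compact

/-!
# `KummerBalanceTransfer` HOLDS: compactly-balanced uniform abc in every bounded degree implies abc

Proof-only file (abc-iut cell, FACT-LIST row F-2685; seat abc-iut-f-135, gen 6) for the ideator-2
«RESTATEMENT CANDIDATE» of crux stmt-ABC-1725 (`CompactBalanceTransfer`, route ABC/CongruentialReceptacle),
`Summit.ABC.ABC.Cruxes.CompactBalanceTransfer.Ideator2.KummerBalanceTransfer :=
(∀ d, UniformBalancedABC d) → ABC` (`Cruxes/CompactBalanceTransfer/Sketch_ideator2_r1.lean`): "compactly-balanced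
uniform abc in EVERY bounded degree implies abc. This is the over-ℚ conclusion of the GenEll Thm 2.1 architecture
… a refereed, IUT-free argument [MochizukiGenEll2010 Thm 2.1]".

It is PROVED here, unconditionally — stated with the hypothesis `∀ d, UniformBalancedABC d` UNFOLDED verbatim
(a `Theorems/` file may not import `Cruxes/`; the closing theorem `abc_of_uniformBalancedABC_allDegrees` is
DEFINITIONALLY the decl `Ideator2.KummerBalanceTransfer`: `example : KummerBalanceTransfer :=
abc_of_uniformBalancedABC_allDegrees` typechecks in any file importing both, kernel probe staged with the cell) —
by composing
* the dictionary `UniformBalancedABC d → VojtaIneq K_V d ε` for EVERY compactly bounded subset `K_V ⊆ U_P(Q̄)`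
  ([GenEll] Ex. 1.3 (ii); tree `GenEll.CBData`): the archimedean bounding domain `K_∞ ⊆ ℂ ∖ {0,1}` is compact,
  so `κ_D := min_{K_∞} min(|z|, |1−z|) > 0` and every point `x ∈ K_V` gives a `κ_D`-balanced solution
  `x + (1 − x) = 1` at every complex embedding; the uniform-abc currency (`Height.mulHeight ![x, 1−x, 1]`, relative
  height `H_F = H^{[F:ℚ]}`; `|D_F|`; Granville–Stark's `radicalNorm`) is read in [GenEll]'s normalised currency by
  `NFPoint.ht ≤ [F:ℚ]⁻¹·log H_F(x, 1−x, 1)` (`Height.mulHeight_comp_le`), `logDiff = [F:ℚ]⁻¹·log|D_F|`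
  (`NFPoint.logDiff_eq_log_discr`), `logCond = [F:ℚ]⁻¹·log radicalNorm(x, 1−x, 1)` (`NFPoint.logCond_eq`);
* hence `(∀ d, UniformBalancedABC d) → ABCCompactlyBounded Σ` for every `Σ` ([GenEll] Thm 2.1 (ii));
* the tree's KERNEL PROOF of [GenEll] Thm. 2.1 (ii) ⇒ (i)|_{ℙ¹} ⇒ abc
  (`GenEll.abc_of_abcCompactlyBounded_of_primes`, `GenEllThm21PrimesHolds.lean`, abc-iut-S6 / w5 crew), at `Σ = ∅`.

HONEST FRAMING: the HYPOTHESIS `∀ d, UniformBalancedABC d` (uniform abc of Granville–Stark / Elkies–Vojta shape for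
compactly balanced points, in all bounded degrees) is an OPEN conjecture; what is proved is the IMPLICATION — [GenEll]
Theorem 2.1 in abc clothing — classical, refereed, outside the IUT dispute. The degree-`1` crux `CompactBalanceTransfer`
(stmt-ABC-1725) is NOT proved here (its hypothesis is balanced abc over `ℚ` only; strength certificate
`Theorems/CompactBalanceTransfer/Negative/StrengthSzpiroToAbc.lean`). Nothing here asserts abc proved or refuted.
-/

set_option linter.dupNamespace false

noncomputable section

namespace Summit.ABC.ABC.Theorems

open Literature.NumberTheory.DiophantineGeometry
open Literature.NumberTheory.DiophantineGeometry.GenEll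
open NumberField

/-- A radical norm is at least `1` (each bad prime contributes `N(𝔭) ≥ 1`; copy of the tree's
`one_le_radicalNorm`, `AbcWave0GranvilleStarkHeightProofs.lean`, not imported to keep this file light). [folklore] -/
private theorem one_le_radicalNorm' {K : Type*} [Field K] [NumberField K] (a b c : K) :
    1 ≤ radicalNorm a b c := by
  rw [radicalNorm, finprod_mem_def]
  refine one_le_finprod' fun v => ?_
  by_cases hv : v ∈ badPrimes a b c
  · rw [Set.mulIndicator_of_mem hv, Nat.one_le_iff_ne_zero, Ne, Ideal.absNorm_eq_zero_iff]
    exact v.ne_bot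
  · rw [Set.mulIndicator_of_notMem hv]

/-- **Archimedean balance of a compactly bounded subset** ([GenEll] Ex. 1.3 (ii)): the bounding domain
`K_∞ ⊆ ℂ ∖ {0, 1}` is compact and nonempty, so there is `κ > 0` with `κ ≤ |z|` and `κ ≤ |1 − z|` for all
`z ∈ K_∞`. [cite: MochizukiGenEll2010, Ex 1.3 (ii) p.6] -/
theorem cbData_exists_balance (D : CBData) :
    ∃ κ : ℝ, 0 < κ ∧ ∀ z ∈ D.Karc, κ ≤ ‖z‖ ∧ κ ≤ ‖1 - z‖ := by
  have hcont : ContinuousOn (fun z : ℂ => min ‖z‖ ‖1 - z‖) D.Karc := by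
    refine Continuous.continuousOn ?_
    exact (continuous_norm).min (continuous_norm.comp (continuous_const.sub continuous_id))
  obtain ⟨z₀, hz₀, hmin⟩ := D.Karc_isCompact.exists_isMinOn D.Karc_nonempty hcont
  have h0 := D.Karc_subset hz₀
  refine ⟨min ‖z₀‖ ‖1 - z₀‖, lt_min (norm_pos_iff.mpr h0.1)
    (norm_pos_iff.mpr (sub_ne_zero.mpr (Ne.symm h0.2))), fun z hz => ?_⟩
  have hle : min ‖z₀‖ ‖1 - z₀‖ ≤ min ‖z‖ ‖1 - z‖ := hmin hz
  exact ⟨hle.trans (min_le_left _ _), hle.trans (min_le_right _ _)⟩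

/-- The two-coordinate height is dominated by the three-coordinate one: `H_F(x, 1) ≤ H_F(x, 1−x, 1)`
(sub-tuple, `Height.mulHeight_comp_le`). [folklore] -/
private theorem mulHeight_pair_le {K : Type*} [Field K] [NumberField K] (x : K) :
    Height.mulHeight ![x, 1] ≤ Height.mulHeight ![x, 1 - x, 1] := by
  have h : (![x, 1] : Fin 2 → K) = ![x, 1 - x, 1] ∘ ![(0 : Fin 3), 2] := by
    funext i
    fin_cases i <;> rfl
  rw [h]
  exact Height.mulHeight_comp_le _ _

/-- **The dictionary: compactly-balanced uniform abc in degree `≤ d` gives [GenEll] Thm. 2.1 (ii) in degree `d`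
on EVERY compactly bounded subset.** For `K_V` ([GenEll] Ex. 1.3 (ii)) with archimedean balance constant `κ_D` and
`P = (F, x) ∈ K_V ∩ U_P(Q̄)^{≤d}`: the solution `x + (1−x) = 1` in `F^×` is `κ_D`-balanced at every `σ : F → ℂ`
(`σ x ∈ K_∞`), so `UniformBalancedABC d` at `(κ_D, ε)` bounds `H_F(x, 1−x, 1) < C^{[F:ℚ]}·(|D_F|·N_F(x,1−x,1))^{1+ε}`;
taking logarithms and dividing by `[F:ℚ]`: `ht(P) ≤ [F:ℚ]⁻¹ log H_F(x,1−x,1) < log C' + (1+ε)(log-diff(P) +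
log-cond(P))`, `C' = max |C| 1`, i.e. `ht ≲ (1+ε)(log-diff + log-cond)` on `K_V ∩ U_P(Q̄)^{≤d}`.
[cite: MochizukiGenEll2010, Thm 2.1 (ii) p.11] -/
theorem vojtaIneq_of_uniformBalancedABC {d : ℕ}
    (h : ∀ κ : ℝ, 0 < κ → ∀ ε : ℝ, 0 < ε → ∃ C : ℝ, ∀ (K : Type) [Field K] [NumberField K] (a b c : K),
      Module.finrank ℚ K ≤ d → a ≠ 0 → b ≠ 0 → c ≠ 0 → a + b = c →
      (∀ σ : K →+* ℂ, κ * ‖σ c‖ ≤ ‖σ a‖ ∧ κ * ‖σ c‖ ≤ ‖σ b‖) →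
        Height.mulHeight ![a, b, c] <
          C ^ Module.finrank ℚ K * ((|NumberField.discr K| : ℝ) * (radicalNorm a b c : ℝ)) ^ (1 + ε))
    (D : CBData) {ε : ℝ} (hε : 0 < ε) : VojtaIneq D.toSet d ε := by
  obtain ⟨κ, hκ, hbal⟩ := cbData_exists_balance D
  obtain ⟨C, hC⟩ := h κ hκ ε hε
  set C' : ℝ := max |C| 1 with hC'
  have hC'1 : 1 ≤ C' := le_max_right _ _
  have hC'0 : 0 < C' := lt_of_lt_of_le one_pos hC'1
  refine ⟨Real.log C', fun P hP => ?_⟩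
  obtain ⟨hmem, hU⟩ := hP
  have hInU : P.InU := CBData.inU_of_mem hmem
  have hdeg : Module.finrank ℚ P.F ≤ d := hU.2
  have hx0 : P.x ≠ 0 := hInU.1
  have hx1 : (1 : P.F) - P.x ≠ 0 := sub_ne_zero.mpr (Ne.symm hInU.2)
  -- uniform balanced abc for the solution `x + (1 - x) = 1` over `P.F`
  have habc := hC P.F P.x (1 - P.x) 1 hdeg hx0 hx1 one_ne_zero (by ring) (fun σ => by
    have hz := hbal (σ P.x) (hmem.1 σ)
    rw [map_one, norm_one, mul_one, map_sub, map_one]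
    exact hz)
  -- the quantities
  set n : ℕ := Module.finrank ℚ P.F with hn
  have hnP : P.degree = n := rfl
  have hn0 : (0 : ℝ) < n := by exact_mod_cast (hnP ▸ P.degree_pos)
  set H : ℝ := Height.mulHeight ![P.x, 1 - P.x, 1] with hH
  have hH0 : 0 < H := Height.mulHeight_pos _
  set Δ : ℝ := (((NumberField.discr P.F).natAbs : ℕ) : ℝ) with hΔ
  have hΔabs : (|(NumberField.discr P.F : ℝ)|) = Δ := by
    rw [hΔ, Nat.cast_natAbs, Int.cast_abs]
  have hΔ0 : 0 < Δ := by
    rw [hΔ]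
    exact_mod_cast Int.natAbs_pos.mpr (NumberField.discr_ne_zero P.F)
  set N : ℝ := ((radicalNorm P.x (1 - P.x) 1 : ℕ) : ℝ) with hN
  have hN0 : 0 < N := by
    rw [hN]
    exact_mod_cast Nat.lt_of_lt_of_le Nat.one_pos (one_le_radicalNorm' P.x (1 - P.x) 1)
  have hM0 : 0 < Δ * N := mul_pos hΔ0 hN0
  -- `H < C^n (Δ N)^{1+ε} ≤ C'^n (Δ N)^{1+ε}`
  have habc' : H < C ^ n * (Δ * N) ^ (1 + ε) := by rw [← hΔabs]; exact habc
  have hpow0 : 0 ≤ (Δ * N) ^ (1 + ε) := Real.rpow_nonneg hM0.le _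
  have hCn : C ^ n ≤ C' ^ n := by
    calc C ^ n ≤ |C ^ n| := le_abs_self _
      _ = |C| ^ n := abs_pow C n
      _ ≤ C' ^ n := pow_le_pow_left₀ (abs_nonneg C) (le_max_left _ _) n
  have hlt : H < C' ^ n * (Δ * N) ^ (1 + ε) :=
    lt_of_lt_of_le habc' (mul_le_mul_of_nonneg_right hCn hpow0)
  -- logarithms
  have hlogH : Real.log H < n * Real.log C' + (1 + ε) * (Real.log Δ + Real.log N) := by
    have h1 : Real.log H < Real.log (C' ^ n * (Δ * N) ^ (1 + ε)) :=
      Real.log_lt_log hH0 hlt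
    rw [Real.log_mul (pow_ne_zero _ hC'0.ne') (Real.rpow_pos_of_pos hM0 _).ne', Real.log_pow,
      Real.log_rpow hM0, Real.log_mul hΔ0.ne' hN0.ne'] at h1
    exact h1
  -- `ht P ≤ n⁻¹ log H`
  have hht : P.ht ≤ (n : ℝ)⁻¹ * Real.log H := by
    rw [NFPoint.ht, hnP, Height.logHeight₁_eq_logHeight, Height.logHeight_eq_log_mulHeight]
    refine mul_le_mul_of_nonneg_left ?_ (inv_nonneg.mpr hn0.le)
    exact Real.log_le_log (Height.mulHeight_pos _) (mulHeight_pair_le P.x)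
  have hdiff : P.logDiff = (n : ℝ)⁻¹ * Real.log Δ := by rw [NFPoint.logDiff_eq_log_discr, hnP]
  have hcond : P.logCond = (n : ℝ)⁻¹ * Real.log N := by rw [NFPoint.logCond_eq, hnP]
  -- assemble: `ht P - (1+ε)(logDiff + logCond) ≤ log C'`
  change P.ht - (1 + ε) * (P.logDiff + P.logCond) ≤ Real.log C'
  rw [hdiff, hcond]
  have hkey : (n : ℝ)⁻¹ * Real.log H ≤ Real.log C' + (1 + ε) * ((n : ℝ)⁻¹ * (Real.log Δ + Real.log N)) := by
    have h2 : (n : ℝ)⁻¹ * Real.log H ≤ (n : ℝ)⁻¹ * (n * Real.log C' + (1 + ε) * (Real.log Δ + Real.log N)) :=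
      mul_le_mul_of_nonneg_left hlogH.le (inv_nonneg.mpr hn0.le)
    have h3 : (n : ℝ)⁻¹ * (n * Real.log C' + (1 + ε) * (Real.log Δ + Real.log N)) =
        Real.log C' + (1 + ε) * ((n : ℝ)⁻¹ * (Real.log Δ + Real.log N)) := by
      field_simp
    linarith [h2, h3.le, h3.ge]
  nlinarith [hht, hkey]

/-- **Compactly-balanced uniform abc in every bounded degree gives statement (ii) of [GenEll] Thm. 2.1 for
EVERY finite set of primes `Σ`** (indeed for every compactly bounded subset, whatever its support).
[cite: MochizukiGenEll2010, Thm 2.1 (ii) p.11] -/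
theorem abcCompactlyBounded_of_uniformBalancedABC
    (h : ∀ d : ℕ, ∀ κ : ℝ, 0 < κ → ∀ ε : ℝ, 0 < ε → ∃ C : ℝ, ∀ (K : Type) [Field K] [NumberField K]
      (a b c : K), Module.finrank ℚ K ≤ d → a ≠ 0 → b ≠ 0 → c ≠ 0 → a + b = c →
      (∀ σ : K →+* ℂ, κ * ‖σ c‖ ≤ ‖σ a‖ ∧ κ * ‖σ c‖ ≤ ‖σ b‖) →
        Height.mulHeight ![a, b, c] <
          C ^ Module.finrank ℚ K * ((|NumberField.discr K| : ℝ) * (radicalNorm a b c : ℝ)) ^ (1 + ε))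
    (S : Finset ℕ) : ABCCompactlyBounded S :=
  fun d _ _ hε D _ => vojtaIneq_of_uniformBalancedABC (h d) D hε

/-- **`KummerBalanceTransfer` HOLDS** (FACT-LIST F-2685; ideator-2 restatement candidate of crux stmt-ABC-1725,
here with its hypothesis `∀ d, UniformBalancedABC d` unfolded verbatim — the statement is definitionally
`Summit.ABC.ABC.Cruxes.CompactBalanceTransfer.Ideator2.KummerBalanceTransfer`): compactly-balanced UNIFORM abc in
every bounded degree implies abc — by the dictionary above and the tree's kernel proof of [GenEll] Thm. 2.1
(ii) ⇒ (i)|_{ℙ¹} ⇒ abc (`GenEll.abc_of_abcCompactlyBounded_of_primes`, at `Σ = ∅`). Unconditional; the hypothesis is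
the open conjecture, the implication is the theorem. [cite: MochizukiGenEll2010, Thm 2.1 p.11] -/
theorem abc_of_uniformBalancedABC_allDegrees
    (h : ∀ d : ℕ, ∀ κ : ℝ, 0 < κ → ∀ ε : ℝ, 0 < ε → ∃ C : ℝ, ∀ (K : Type) [Field K] [NumberField K]
      (a b c : K), Module.finrank ℚ K ≤ d → a ≠ 0 → b ≠ 0 → c ≠ 0 → a + b = c →
      (∀ σ : K →+* ℂ, κ * ‖σ c‖ ≤ ‖σ a‖ ∧ κ * ‖σ c‖ ≤ ‖σ b‖) →
        Height.mulHeight ![a, b, c] <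
          C ^ Module.finrank ℚ K * ((|NumberField.discr K| : ℝ) * (radicalNorm a b c : ℝ)) ^ (1 + ε)) :
    _root_.ABC :=
  abc_of_abcCompactlyBounded_of_primes (S := ∅) (fun _ hp => absurd hp (Finset.notMem_empty _))
    (abcCompactlyBounded_of_uniformBalancedABC h ∅)

end Summit.ABC.ABC.Theorems

end
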